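import Summits.Parity.BatemanHorn.Theorems.SoloInformedPartialSummation
import Summits.Parity.BatemanHorn.Theorems.SoloInformedPolynomialGrowth

/-!
# SoloInformedPolynomialPrimeCount — the `π`-level of the localisation for every one-polynomial Bateman–Horn system

Solo unit `solo-Parity-informed` (ideation tier, informed mode), session 12; `PLAN.md` §20, CLAIMS C53.

For `g ∈ ℤ[X]` with `IsBatemanHornSystem ![g]` (irreducible, positive leading coefficient, no fixed prime divisor),
`d = deg g`, `C(g) = batemanHornConst ![g] > 0` (PROVED in the tree), write

  `π_g(x) = polyPrimeCount ![g] x = #{0 ≤ n ≤ x : g(n) > 0 prime}`     (the conjunct's counting function),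
  `θ_g(x) = ∑_{1 ≤ n ≤ x, |g(n)| prime} log |g(n)|`,   `ψ_g(x) = ∑_{1 ≤ n ≤ x} Λ(|g(n)|) = θ_g(x) + PP_g(x)`,
  `PP_g(x) = ∑_{1 ≤ n ≤ x, |g(n)| not prime} Λ(|g(n)|) ≥ 0`            (proper prime-power values),
  `T_g(x; y) = ∑_{1 ≤ n ≤ x} ∑_{d ∣ |g(n)|, d > y} μ(d) log d`          (as in `SoloInformedGeneralPolynomialSplit`).

Results (the instance of the conjunct is `BatemanHornAsymptotic ![g]`, i.e. `π_g(x) ~ (C(g)/d) x/log x` once the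
convergence of the product is known):

* `batemanHornAsymptotic_iff_isEquivalent_card`, `batemanHornAsymptotic_iff_isEquivalent_theta` — UNCONDITIONALLY,
  for every one-polynomial system: `BatemanHornAsymptotic ![g] ⟺ #{n ≤ x : |g(n)| prime} ~ (C(g)/d) x/log x ⟺ θ_g(x) ~ C(g) x`
  (partial summation `SoloInformedPartialSummation` with the weights `log |g(n)| = d log n + O(1)` of
  `SoloInformedPolynomialGrowth`; the two counts differ by `O(1)`);
* one-sided, unconditional (`deg g ≥ 2` where `T_g` enters):
  `eventually_polyPrimeCount_le_of_largeDivisorSum_isLittleO` — `T_g(x; x^{1-ε}) = o(x) ⟹ π_g(x) ≤ (1+δ)(C(g)/d) x/log x`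
  eventually, every `δ > 0` (the full UPPER half of Bateman–Horn for `g`);
  `eventually_largeDivisorSum_le_of_batemanHornAsymptotic` — `BatemanHornAsymptotic ![g] ⟹ T_g(x; y) ≤ δ x` eventually,
  every admissible cut and every `δ > 0`;
* two-sided under `PP_g = o(x)` (proper prime powers among the values are negligible — automatic for `deg g = 2`,
  see `SoloInformedQuadraticPrimeCount`; open in this elementary form for `deg g ≥ 3`):
  `batemanHornAsymptotic_iff_largeDivisorSum_isLittleO_of_properPrimePow` —
      `BatemanHornAsymptotic ![g] ⟺ T_g(x; y(x)) = o(x)`   for every admissible cut (`y → ∞`, `y log y = o(x)`).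

So the one-polynomial sub-family of the conjunct `BatemanHorn` is, polynomial by polynomial, the statement that
`μ · log` cancels over the divisors `d > x^{1-ε}` of the values `|g(n)| ≍ x^d` — up to the proper-prime-power term,
which is the only place where `π` and `ψ` differ.  No bearing on the truth of the conjecture.
-/

namespace Summit.Parity.BatemanHorn.Theorems

open Finset Filter ArithmeticFunction Asymptotics Polynomial
open scoped ArithmeticFunction.Moebius Topology
open Literature.NumberTheory.Sieve (polyPrimeCount IsBatemanHornSystem batemanHornConst HasBatemanHornConst
  BatemanHornAsymptotic tendsto_natCast_div_log_atTop)

/-! ### `polyPrimeCount ![g]` versus `#{1 ≤ n ≤ x : |g(n)| prime}` -/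

/-- For a single polynomial, `polyPrimeCount ![g] x = #{0 ≤ n ≤ x : g(n) > 0 and prime}`. -/
theorem polyPrimeCount_fin_one (g : ℤ[X]) (x : ℕ) :
    polyPrimeCount ![g] x
      = #((range (x + 1)).filter fun n : ℕ => 0 < g.eval (n : ℤ) ∧ Nat.Prime (g.eval (n : ℤ)).toNat) := by
  unfold polyPrimeCount
  simp only [Fin.forall_fin_one, Matrix.cons_val_fin_one]

/-- `π_g(x) ≤ #{1 ≤ n ≤ x : |g(n)| prime} + 1` (the `+1` accounts for `n = 0`). -/
theorem polyPrimeCount_le_card_add_one (g : ℤ[X]) (x : ℕ) :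
    polyPrimeCount ![g] x ≤ #((Icc 1 x).filter fun n : ℕ => Nat.Prime (g.eval (n : ℤ)).natAbs) + 1 := by
  rw [polyPrimeCount_fin_one]
  calc #((range (x + 1)).filter fun n : ℕ => 0 < g.eval (n : ℤ) ∧ Nat.Prime (g.eval (n : ℤ)).toNat)
      ≤ #(insert 0 ((Icc 1 x).filter fun n : ℕ => Nat.Prime (g.eval (n : ℤ)).natAbs)) := by
        refine card_le_card fun n hn => ?_
        rw [mem_filter, mem_range] at hn
        obtain ⟨hnx, hpos, hprime⟩ := hn
        rw [mem_insert]
        rcases Nat.eq_zero_or_pos n with h0 | h0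
        · exact Or.inl h0
        · refine Or.inr (mem_filter.mpr ⟨mem_Icc.mpr ⟨h0, by omega⟩, ?_⟩)
          have h : (g.eval (n : ℤ)).toNat = (g.eval (n : ℤ)).natAbs := by omega
          rwa [h] at hprime
    _ ≤ _ := card_insert_le _ _

/-- `#{1 ≤ n ≤ x : |g(n)| prime} ≤ π_g(x) + n₀` once `g(n) > 0` for `n ≥ n₀`. -/
theorem card_le_polyPrimeCount_add (g : ℤ[X]) {n₀ : ℕ} (hpos : ∀ n : ℕ, n₀ ≤ n → 0 < g.eval (n : ℤ))
    (x : ℕ) :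
    #((Icc 1 x).filter fun n : ℕ => Nat.Prime (g.eval (n : ℤ)).natAbs) ≤ polyPrimeCount ![g] x + n₀ := by
  rw [polyPrimeCount_fin_one]
  calc #((Icc 1 x).filter fun n : ℕ => Nat.Prime (g.eval (n : ℤ)).natAbs)
      ≤ #(((range (x + 1)).filter fun n : ℕ => 0 < g.eval (n : ℤ) ∧ Nat.Prime (g.eval (n : ℤ)).toNat)
          ∪ range n₀) := by
        refine card_le_card fun n hn => ?_
        rw [mem_filter, mem_Icc] at hn
        obtain ⟨⟨hn1, hnx⟩, hprime⟩ := hn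
        rw [mem_union, mem_filter, mem_range, mem_range]
        rcases Nat.lt_or_ge n n₀ with h | h
        · exact Or.inr h
        · have hp := hpos n h
          have h' : (g.eval (n : ℤ)).toNat = (g.eval (n : ℤ)).natAbs := by omega
          refine Or.inl ⟨by omega, hp, ?_⟩
          rwa [h']
    _ ≤ #((range (x + 1)).filter fun n : ℕ => 0 < g.eval (n : ℤ) ∧ Nat.Prime (g.eval (n : ℤ)).toNat)
          + #(range n₀) := card_union_le _ _
    _ = _ := by rw [card_range]

/-- Two real sequences at bounded distance are asymptotic to the same function tending to `+∞`. -/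
theorem isEquivalent_of_abs_sub_le {u u' v : ℕ → ℝ} {K : ℝ} (hK : ∀ x : ℕ, |u' x - u x| ≤ K)
    (hv : Tendsto v atTop atTop) (h : u ~[atTop] v) : u' ~[atTop] v := by
  have hw : (fun x : ℕ => u' x - u x) =o[atTop] v := by
    rw [isLittleO_iff]
    intro c hc
    filter_upwards [hv.eventually_ge_atTop (K / c)] with x hx
    rw [Real.norm_eq_abs, Real.norm_eq_abs]
    have hKc : K ≤ c * v x := by
      have := (div_le_iff₀ hc).mp hx
      linarith
    calc |u' x - u x| ≤ K := hK x
      _ ≤ c * v x := hKc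
      _ ≤ c * |v x| := by gcongr; exact le_abs_self _
  refine (h.add_isLittleO hw).congr_left (Eventually.of_forall fun x => ?_)
  simp only [Pi.add_apply]
  ring

/-- `K x/log x → ∞` along `ℕ` for `K > 0`. -/
theorem tendsto_const_mul_div_log_atTop {K : ℝ} (hK : 0 < K) :
    Tendsto (fun x : ℕ => K * (x : ℝ) / Real.log x) atTop atTop :=
  (tendsto_natCast_div_log_atTop.const_mul_atTop hK).congr fun _ => (mul_div_assoc _ _ _).symm

/-! ### `π`-level ⟺ count of prime `|g(n)|` ⟺ `θ`-level (unconditional) -/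

/-- **`BatemanHornAsymptotic ![g] ⟺ #{1 ≤ n ≤ x : |g(n)| prime} ~ (C(g)/deg g) · x/log x`** for every
one-polynomial Bateman–Horn system (the constant of the conjunct is forced to be `C(g)` by the proved convergence
of the product, and the two counts differ by `O(1)`). -/
theorem batemanHornAsymptotic_iff_isEquivalent_card {g : ℤ[X]} (hg : IsBatemanHornSystem ![g]) :
    BatemanHornAsymptotic ![g] ↔
      (fun x : ℕ => (#((Icc 1 x).filter fun n : ℕ => Nat.Prime (g.eval (n : ℤ)).natAbs) : ℝ)) ~[atTop]
        fun x : ℕ => batemanHornConst ![g] / g.natDegree * (x : ℝ) / Real.log x := by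
  obtain ⟨hconst, hCpos⟩ := IsBatemanHornSystem.hasBatemanHornConst_holds hg
  have hdeg : 0 < g.natDegree := by simpa using hg.natDegree_pos 0
  have hlc : 0 < g.leadingCoeff := by simpa using hg.leadingCoeff_pos 0
  obtain ⟨n₀, hn₀⟩ := exists_eval_natCast_pos hdeg hlc
  have hdR : (0 : ℝ) < g.natDegree := Nat.cast_pos.mpr hdeg
  have hmain : Tendsto (fun x : ℕ => batemanHornConst ![g] / g.natDegree * (x : ℝ) / Real.log x)
      atTop atTop :=
    tendsto_const_mul_div_log_atTop (by positivity)
  have hdiff : ∀ x : ℕ,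
      |(#((Icc 1 x).filter fun n : ℕ => Nat.Prime (g.eval (n : ℤ)).natAbs) : ℝ) - (polyPrimeCount ![g] x : ℝ)|
        ≤ n₀ + 1 := by
    intro x
    have h1 : (polyPrimeCount ![g] x : ℝ)
        ≤ (#((Icc 1 x).filter fun n : ℕ => Nat.Prime (g.eval (n : ℤ)).natAbs) : ℝ) + 1 := by
      exact_mod_cast polyPrimeCount_le_card_add_one g x
    have h2 : (#((Icc 1 x).filter fun n : ℕ => Nat.Prime (g.eval (n : ℤ)).natAbs) : ℝ)
        ≤ (polyPrimeCount ![g] x : ℝ) + n₀ := by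
      exact_mod_cast card_le_polyPrimeCount_add g hn₀ x
    rw [abs_le]
    constructor <;> linarith
  have hdiff' : ∀ x : ℕ,
      |(polyPrimeCount ![g] x : ℝ) - (#((Icc 1 x).filter fun n : ℕ => Nat.Prime (g.eval (n : ℤ)).natAbs) : ℝ)|
        ≤ n₀ + 1 := fun x => by
    rw [abs_sub_comm]
    exact hdiff x
  unfold BatemanHornAsymptotic
  simp only [Fin.prod_univ_one, Matrix.cons_val_fin_one, Fintype.card_fin, pow_one]
  constructor
  · rintro ⟨C, hC, hπ⟩
    have hCeq : C = batemanHornConst ![g] := tendsto_nhds_unique hC hconst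
    rw [hCeq] at hπ
    exact isEquivalent_of_abs_sub_le hdiff hmain hπ
  · intro h
    exact ⟨_, hconst, isEquivalent_of_abs_sub_le hdiff' hmain h⟩

/-- **`BatemanHornAsymptotic ![g] ⟺ θ_g(x) ~ C(g) x`** for every one-polynomial Bateman–Horn system: the
partial summation with the weights `log |g(n)| = deg g · log n + O(1)`. -/
theorem batemanHornAsymptotic_iff_isEquivalent_theta {g : ℤ[X]} (hg : IsBatemanHornSystem ![g]) :
    BatemanHornAsymptotic ![g] ↔
      (fun x : ℕ => ∑ n ∈ (Icc 1 x).filter (fun n : ℕ => Nat.Prime (g.eval (n : ℤ)).natAbs),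
          Real.log (((g.eval (n : ℤ)).natAbs : ℕ) : ℝ)) ~[atTop]
        fun x : ℕ => batemanHornConst ![g] * (x : ℝ) := by
  obtain ⟨-, hCpos⟩ := IsBatemanHornSystem.hasBatemanHornConst_holds hg
  have hdeg : 0 < g.natDegree := by simpa using hg.natDegree_pos 0
  obtain ⟨B, hB⟩ := exists_abs_log_natAbs_eval_sub_le hdeg
  rw [batemanHornAsymptotic_iff_isEquivalent_card hg]
  exact (isEquivalent_weightedSum_iff_card (p := fun n : ℕ => Nat.Prime (g.eval (n : ℤ)).natAbs)
    (w := fun n : ℕ => Real.log (((g.eval (n : ℤ)).natAbs : ℕ) : ℝ))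
    (Nat.cast_pos.mpr hdeg) hCpos (fun n => Real.log_natCast_nonneg _) hB).symm

/-! ### `ψ_g = θ_g + PP_g` and the one-sided unconditional statements -/

/-- `ψ_g(x) = θ_g(x) + PP_g(x)`: on prime values `Λ = log`, the rest is the proper-prime-power term. -/
theorem sum_vonMangoldt_polyVal_eq_theta_add (g : ℤ[X]) (x : ℕ) :
    ∑ n ∈ Icc 1 x, Λ (g.eval (n : ℤ)).natAbs
      = ∑ n ∈ (Icc 1 x).filter (fun n : ℕ => Nat.Prime (g.eval (n : ℤ)).natAbs),
            Real.log (((g.eval (n : ℤ)).natAbs : ℕ) : ℝ)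
        + ∑ n ∈ (Icc 1 x).filter (fun n : ℕ => ¬Nat.Prime (g.eval (n : ℤ)).natAbs),
            Λ (g.eval (n : ℤ)).natAbs := by
  rw [← sum_filter_add_sum_filter_not (Icc 1 x) (fun n : ℕ => Nat.Prime (g.eval (n : ℤ)).natAbs)
    (fun n : ℕ => Λ (g.eval (n : ℤ)).natAbs)]
  congr 1
  exact sum_congr rfl fun n hn => vonMangoldt_apply_prime (mem_filter.mp hn).2

/-- `θ_g(x) ≤ ψ_g(x)` (`Λ ≥ 0`). -/
theorem theta_le_psi (g : ℤ[X]) (x : ℕ) :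
    ∑ n ∈ (Icc 1 x).filter (fun n : ℕ => Nat.Prime (g.eval (n : ℤ)).natAbs),
        Real.log (((g.eval (n : ℤ)).natAbs : ℕ) : ℝ)
      ≤ ∑ n ∈ Icc 1 x, Λ (g.eval (n : ℤ)).natAbs := by
  rw [sum_vonMangoldt_polyVal_eq_theta_add]
  have h : 0 ≤ ∑ n ∈ (Icc 1 x).filter (fun n : ℕ => ¬Nat.Prime (g.eval (n : ℤ)).natAbs),
      Λ (g.eval (n : ℤ)).natAbs := sum_nonneg fun n _ => vonMangoldt_nonneg
  linarith

/-- **`ψ_g(x) ~ C(g) x ⟹` the upper half of Bateman–Horn for `g`**: `π_g(x) ≤ (1 + δ)(C(g)/deg g) x/log x`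
eventually, for every `δ > 0` (unconditional in the prime-power term, since `θ_g ≤ ψ_g`). -/
theorem eventually_polyPrimeCount_le_of_isEquivalent_psi {g : ℤ[X]} (hg : IsBatemanHornSystem ![g])
    (hψ : (fun x : ℕ => ∑ n ∈ Icc 1 x, Λ (g.eval (n : ℤ)).natAbs) ~[atTop]
      fun x : ℕ => batemanHornConst ![g] * (x : ℝ)) {δ : ℝ} (hδ : 0 < δ) :
    ∀ᶠ x : ℕ in atTop, (polyPrimeCount ![g] x : ℝ)
      ≤ (1 + δ) * (batemanHornConst ![g] / g.natDegree * (x : ℝ) / Real.log x) := by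
  obtain ⟨-, hCpos⟩ := IsBatemanHornSystem.hasBatemanHornConst_holds hg
  have hdeg : 0 < g.natDegree := by simpa using hg.natDegree_pos 0
  have hdR : (0 : ℝ) < g.natDegree := Nat.cast_pos.mpr hdeg
  obtain ⟨B, hB⟩ := exists_abs_log_natAbs_eval_sub_le hdeg
  have hv1 : ∀ᶠ x : ℕ in atTop, 0 < batemanHornConst ![g] * (x : ℝ) := by
    filter_upwards [eventually_ge_atTop 1] with x hx
    have : (0 : ℝ) < x := Nat.cast_pos.mpr (by omega)
    positivity
  obtain ⟨hψU, -⟩ := (isEquivalent_iff_upper_lower hv1).mp hψ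
  have hθU : ∀ c : ℝ, 0 < c → ∀ᶠ x : ℕ in atTop,
      ∑ n ∈ (Icc 1 x).filter (fun n : ℕ => Nat.Prime (g.eval (n : ℤ)).natAbs),
          Real.log (((g.eval (n : ℤ)).natAbs : ℕ) : ℝ)
        ≤ (1 + c) * (batemanHornConst ![g] * x) := fun c hc => by
    filter_upwards [hψU c hc] with x hx
    exact (theta_le_psi g x).trans hx
  have hP := eventually_card_le_of_weightedSum_le (p := fun n : ℕ => Nat.Prime (g.eval (n : ℤ)).natAbs)
    (w := fun n : ℕ => Real.log (((g.eval (n : ℤ)).natAbs : ℕ) : ℝ)) hdR hCpos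
    (fun n => Real.log_natCast_nonneg _) hB hθU (δ / 2) (by positivity)
  have hmain := tendsto_const_mul_div_log_atTop (K := batemanHornConst ![g] / g.natDegree) (by positivity)
  filter_upwards [hP, hmain.eventually_ge_atTop (2 / δ)] with x hx hx2
  have h1 : (polyPrimeCount ![g] x : ℝ)
      ≤ (#((Icc 1 x).filter fun n : ℕ => Nat.Prime (g.eval (n : ℤ)).natAbs) : ℝ) + 1 := by
    exact_mod_cast polyPrimeCount_le_card_add_one g x
  have h2 : (1 : ℝ) ≤ δ / 2 * (batemanHornConst ![g] / g.natDegree * (x : ℝ) / Real.log x) := by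
    have := (div_le_iff₀ hδ).mp hx2
    linarith
  linarith

/-- **`T_g(x; x^{1-ε}) = o(x) ⟹` the upper half of Bateman–Horn for `g`** (`deg g ≥ 2`, `0 < ε < 1`): for every
`δ > 0`, eventually `π_g(x) ≤ (1 + δ) (C(g)/deg g) · x/log x`. -/
theorem eventually_polyPrimeCount_le_of_largeDivisorSum_isLittleO {g : ℤ[X]} (hg : IsBatemanHornSystem ![g])
    (hdeg : 2 ≤ g.natDegree) {ε : ℝ} (hε : 0 < ε) (hε1 : ε < 1)
    (hT : (fun x : ℕ => ∑ n ∈ Icc 1 x,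
        ∑ e ∈ ((g.eval (n : ℤ)).natAbs).divisors with ⌊(x : ℝ) ^ (1 - ε)⌋₊ < (g.eval (n : ℤ)).natAbs / e,
          (μ ((g.eval (n : ℤ)).natAbs / e) : ℝ) * Real.log ((((g.eval (n : ℤ)).natAbs / e : ℕ)) : ℝ))
      =o[atTop] fun x : ℕ => (x : ℝ)) {δ : ℝ} (hδ : 0 < δ) :
    ∀ᶠ x : ℕ in atTop, (polyPrimeCount ![g] x : ℝ)
      ≤ (1 + δ) * (batemanHornConst ![g] / g.natDegree * (x : ℝ) / Real.log x) :=
  eventually_polyPrimeCount_le_of_isEquivalent_psi hg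
    ((isEquivalent_sum_vonMangoldt_polyVal_iff_largeDivisorSum_isLittleO hg hdeg hε hε1).mpr hT) hδ

/-- **`BatemanHornAsymptotic ![g] ⟹ ψ_g(x) ≥ (1 - δ) C(g) x` eventually**, every `δ > 0` (via `θ_g ≤ ψ_g`). -/
theorem eventually_le_psi_of_batemanHornAsymptotic {g : ℤ[X]} (hg : IsBatemanHornSystem ![g])
    (hBH : BatemanHornAsymptotic ![g]) {δ : ℝ} (hδ : 0 < δ) :
    ∀ᶠ x : ℕ in atTop,
      (1 - δ) * (batemanHornConst ![g] * (x : ℝ)) ≤ ∑ n ∈ Icc 1 x, Λ (g.eval (n : ℤ)).natAbs := by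
  obtain ⟨-, hCpos⟩ := IsBatemanHornSystem.hasBatemanHornConst_holds hg
  have hθ := (batemanHornAsymptotic_iff_isEquivalent_theta hg).mp hBH
  have hv1 : ∀ᶠ x : ℕ in atTop, 0 < batemanHornConst ![g] * (x : ℝ) := by
    filter_upwards [eventually_ge_atTop 1] with x hx
    have : (0 : ℝ) < x := Nat.cast_pos.mpr (by omega)
    positivity
  obtain ⟨-, hθL⟩ := (isEquivalent_iff_upper_lower hv1).mp hθ
  filter_upwards [hθL δ hδ] with x hx
  exact hx.trans (theta_le_psi g x)

/-- **`BatemanHornAsymptotic ![g] ⟹ T_g(x; y(x)) ≤ δ x` eventually**, for every admissible cut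
(`y → ∞`, `y log y = o(x)`) and every `δ > 0` (`deg g ≥ 2`): the conjunct bounds the large-divisor
Möbius–log sum from above, unconditionally in the prime-power term. -/
theorem eventually_largeDivisorSum_le_of_batemanHornAsymptotic {g : ℤ[X]} (hg : IsBatemanHornSystem ![g])
    (hdeg : 2 ≤ g.natDegree) {y : ℕ → ℕ} (hy : Tendsto y atTop atTop)
    (hy' : (fun x : ℕ => Real.log (y x) * (y x : ℝ)) =o[atTop] fun x : ℕ => (x : ℝ))
    (hBH : BatemanHornAsymptotic ![g]) {δ : ℝ} (hδ : 0 < δ) :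
    ∀ᶠ x : ℕ in atTop,
      ∑ n ∈ Icc 1 x,
          ∑ e ∈ ((g.eval (n : ℤ)).natAbs).divisors with y x < (g.eval (n : ℤ)).natAbs / e,
            (μ ((g.eval (n : ℤ)).natAbs / e) : ℝ) * Real.log ((((g.eval (n : ℤ)).natAbs / e : ℕ)) : ℝ)
        ≤ δ * x := by
  obtain ⟨-, hCpos⟩ := IsBatemanHornSystem.hasBatemanHornConst_holds hg
  have hirr : Irreducible g := by simpa using hg.irreducible 0
  have hg0 := eval_natCast_ne_zero_of_irreducible hirr hdeg
  have hE := polyMainError_isLittleO_of_cut hg hy hy'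
  have hψ := eventually_le_psi_of_batemanHornAsymptotic hg hBH
    (δ := δ / 2 / batemanHornConst ![g]) (by positivity)
  filter_upwards [hE.bound (show (0 : ℝ) < δ / 2 by positivity), hψ] with x hx1 hx2
  have hx0 : (0 : ℝ) ≤ x := Nat.cast_nonneg x
  have hid := sum_vonMangoldt_polyVal_sub_add_largeDivisorSum_eq g hg0 x (y x) (batemanHornConst ![g])
  have hx1' : |(x : ℝ) * ((-∑ d ∈ Icc 1 (y x), (μ d : ℝ) * Real.log d
      * (Literature.NumberTheory.Sieve.polyRootCountMod ![g] d : ℝ) / d) - batemanHornConst ![g])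
        - ∑ d ∈ Icc 1 (y x), (μ d : ℝ) * Real.log d
            * ((#((Icc 1 x).filter fun n : ℕ => (d : ℤ) ∣ g.eval (n : ℤ)) : ℝ)
                - (x : ℝ) * (Literature.NumberTheory.Sieve.polyRootCountMod ![g] d : ℝ) / d)|
      ≤ δ / 2 * x := by
    simpa only [Real.norm_eq_abs, abs_of_nonneg hx0] using hx1
  have hE' := (abs_le.mp hx1').2
  have hψ' : (1 - δ / 2 / batemanHornConst ![g]) * (batemanHornConst ![g] * (x : ℝ))
      = batemanHornConst ![g] * x - δ / 2 * x := by
    field_simp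
  rw [hψ'] at hx2
  linarith

/-! ### The two-sided statement under negligible proper prime powers -/

/-- **`BatemanHornAsymptotic ![g] ⟺ ψ_g(x) ~ C(g) x` when `PP_g(x) = o(x)`.** -/
theorem batemanHornAsymptotic_iff_isEquivalent_psi_of_properPrimePow {g : ℤ[X]}
    (hg : IsBatemanHornSystem ![g])
    (hPP : (fun x : ℕ => ∑ n ∈ (Icc 1 x).filter (fun n : ℕ => ¬Nat.Prime (g.eval (n : ℤ)).natAbs),
        Λ (g.eval (n : ℤ)).natAbs) =o[atTop] fun x : ℕ => (x : ℝ)) :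
    BatemanHornAsymptotic ![g] ↔
      ((fun x : ℕ => ∑ n ∈ Icc 1 x, Λ (g.eval (n : ℤ)).natAbs) ~[atTop]
        fun x : ℕ => batemanHornConst ![g] * (x : ℝ)) := by
  obtain ⟨-, hCpos⟩ := IsBatemanHornSystem.hasBatemanHornConst_holds hg
  rw [batemanHornAsymptotic_iff_isEquivalent_theta hg]
  have hPP' : (fun x : ℕ => ∑ n ∈ (Icc 1 x).filter (fun n : ℕ => ¬Nat.Prime (g.eval (n : ℤ)).natAbs),
      Λ (g.eval (n : ℤ)).natAbs) =o[atTop] fun x : ℕ => batemanHornConst ![g] * (x : ℝ) :=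
    hPP.trans_isBigO (isBigO_self_const_mul hCpos.ne' (fun x : ℕ => (x : ℝ)) atTop)
  have hψfun : (fun x : ℕ => ∑ n ∈ Icc 1 x, Λ (g.eval (n : ℤ)).natAbs)
      = (fun x : ℕ => ∑ n ∈ (Icc 1 x).filter (fun n : ℕ => Nat.Prime (g.eval (n : ℤ)).natAbs),
          Real.log (((g.eval (n : ℤ)).natAbs : ℕ) : ℝ))
        + fun x : ℕ => ∑ n ∈ (Icc 1 x).filter (fun n : ℕ => ¬Nat.Prime (g.eval (n : ℤ)).natAbs),
            Λ (g.eval (n : ℤ)).natAbs := by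
    funext x
    exact sum_vonMangoldt_polyVal_eq_theta_add g x
  have hθfun : (fun x : ℕ => ∑ n ∈ (Icc 1 x).filter (fun n : ℕ => Nat.Prime (g.eval (n : ℤ)).natAbs),
          Real.log (((g.eval (n : ℤ)).natAbs : ℕ) : ℝ))
      = (fun x : ℕ => ∑ n ∈ Icc 1 x, Λ (g.eval (n : ℤ)).natAbs)
        + fun x : ℕ => -∑ n ∈ (Icc 1 x).filter (fun n : ℕ => ¬Nat.Prime (g.eval (n : ℤ)).natAbs),
            Λ (g.eval (n : ℤ)).natAbs := by
    funext x
    simp only [Pi.add_apply]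
    rw [sum_vonMangoldt_polyVal_eq_theta_add g x]
    ring
  constructor
  · intro hθ
    rw [hψfun]
    exact hθ.add_isLittleO hPP'
  · intro hψ
    rw [hθfun]
    exact hψ.add_isLittleO hPP'.neg_left

/-- **`BatemanHornAsymptotic ![g] ⟺ T_g(x; y(x)) = o(x)` when `PP_g(x) = o(x)`**, for every admissible cut
(`deg g ≥ 2`; `y → ∞`, `y log y = o(x)`): the `π`-level localisation of one-polynomial Bateman–Horn. -/
theorem batemanHornAsymptotic_iff_largeDivisorSum_isLittleO_of_properPrimePow {g : ℤ[X]}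
    (hg : IsBatemanHornSystem ![g]) (hdeg : 2 ≤ g.natDegree)
    (hPP : (fun x : ℕ => ∑ n ∈ (Icc 1 x).filter (fun n : ℕ => ¬Nat.Prime (g.eval (n : ℤ)).natAbs),
        Λ (g.eval (n : ℤ)).natAbs) =o[atTop] fun x : ℕ => (x : ℝ))
    {y : ℕ → ℕ} (hy : Tendsto y atTop atTop)
    (hy' : (fun x : ℕ => Real.log (y x) * (y x : ℝ)) =o[atTop] fun x : ℕ => (x : ℝ)) :
    BatemanHornAsymptotic ![g] ↔
      (fun x : ℕ => ∑ n ∈ Icc 1 x,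
          ∑ e ∈ ((g.eval (n : ℤ)).natAbs).divisors with y x < (g.eval (n : ℤ)).natAbs / e,
            (μ ((g.eval (n : ℤ)).natAbs / e) : ℝ) * Real.log ((((g.eval (n : ℤ)).natAbs / e : ℕ)) : ℝ))
        =o[atTop] fun x : ℕ => (x : ℝ) :=
  (batemanHornAsymptotic_iff_isEquivalent_psi_of_properPrimePow hg hPP).trans
    (isEquivalent_sum_vonMangoldt_polyVal_iff_largeDivisorSum_isLittleO_of_cut' hg hdeg hy hy')

/-- The same at the cut `y = ⌊x^{1-ε}⌋` (`0 < ε < 1`). -/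
theorem batemanHornAsymptotic_iff_largeDivisorSum_isLittleO_rpowCut_of_properPrimePow {g : ℤ[X]}
    (hg : IsBatemanHornSystem ![g]) (hdeg : 2 ≤ g.natDegree)
    (hPP : (fun x : ℕ => ∑ n ∈ (Icc 1 x).filter (fun n : ℕ => ¬Nat.Prime (g.eval (n : ℤ)).natAbs),
        Λ (g.eval (n : ℤ)).natAbs) =o[atTop] fun x : ℕ => (x : ℝ)) {ε : ℝ} (hε : 0 < ε) (hε1 : ε < 1) :
    BatemanHornAsymptotic ![g] ↔
      (fun x : ℕ => ∑ n ∈ Icc 1 x,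
          ∑ e ∈ ((g.eval (n : ℤ)).natAbs).divisors with ⌊(x : ℝ) ^ (1 - ε)⌋₊ < (g.eval (n : ℤ)).natAbs / e,
            (μ ((g.eval (n : ℤ)).natAbs / e) : ℝ) * Real.log ((((g.eval (n : ℤ)).natAbs / e : ℕ)) : ℝ))
        =o[atTop] fun x : ℕ => (x : ℝ) :=
  batemanHornAsymptotic_iff_largeDivisorSum_isLittleO_of_properPrimePow hg hdeg hPP
    (tendsto_floor_rpow_atTop (by linarith)) (rpowCut_mul_log_isLittleO hε hε1)

end Summit.Parity.BatemanHorn.Theorems
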